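import Mathlib.NumberTheory.ArithmeticFunction.Moebius
import Mathlib.NumberTheory.PrimeCounting
import Mathlib.Analysis.SpecialFunctions.Pow.Complex
import Mathlib.Analysis.SpecialFunctions.Complex.LogBounds
import Mathlib.NumberTheory.Harmonic.EulerMascheroni
import HarnessLib

/-!
# Granville–Soundararajan, *Decay of mean values of multiplicative functions* (2003)

Topic `NumberTheory/LFunctions`.  Named facts from A. Granville, K. Soundararajan, *Decay of mean
values of multiplicative functions*, Canad. J. Math. 55 (2003), 1191–1230 (held as the arXiv
version `math/9911246`, 13 pp.; references.bib key `GranvilleSoundararajan2003`), vendored as the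
inputs "[GS03]" of the proof of **Lemma 4 of Matomäki–Radziwiłł** (Ann. of Math. 183 (2016), §3:
the Lipschitz estimate `MatomakiRadziwill2016_lemma4` of
`Literature/NumberTheory/Sieve/MatomakiRadziwill.lean`), whose printed proof invokes "Halász's
theorem (see for instance [GS03])", the lower bound for the pretentious distance at `|t| ≥ 1/100`
("by partial summation and the prime number theorem" — here GS03's Lemma 2.3), and "By [GS03]"
the twisted Lipschitz bound (GS03's Theorem 4).  Every named fact of this file that is not
deprecated is by now DISCHARGED downstream (the `…_holds` theorems named below).

## Content

* `eulerFactor f p s = ∑_{k ≥ 0} f(p^k) p^{-ks}` and `truncEulerProduct f x s = ∏_{p ≤ x} eulerFactor f p s`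
  — DEFINITIONS: the function `F(s) = ∏_{p ≤ x} (1 + f(p)/p^s + f(p²)/p^{2s} + …)` of GS03, Theorem 1
  (for multiplicative `f`, `f(1) = 1` is the printed leading `1`); `summable_eulerFactor` (absolute
  convergence for `Re s > 0`, `|f| ≤ 1`).
* `GranvilleSoundararajan2003_theorem1` — NAMED FACT (Theorem 1, the sharp Halász theorem):
  `x⁻¹|∑_{n≤x} f(n)| ≤ L(log(e^γ/L) + 12/7) + O(1/T + log log x/log x)`,
  `L = (log x)⁻¹ max_{|y| ≤ 2T} |F(1+iy)|`.  PROVED downstream: `GranvilleSoundararajan2003_theorem1_holds`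
  (`GranvilleSoundararajan2003Proofs.lean`).
* `GranvilleSoundararajan2003_lemma23` — NAMED FACT (Lemma 2.3): for all real `y` and
  `1/log x ≤ |β| ≤ log x`, `|F(1+iy) F(1+i(y+β))| ≪ (log x)^{4/π} max(1/|β|, (log log x)²)^{2(1-2/π)}`.
  PROVED downstream: `GranvilleSoundararajan2003_lemma23_holds` (`GranvilleSoundararajanLemma23.lean`).
* `GranvilleSoundararajan2003_lemma71` — NAMED FACT (Lemma 7.1, untwisting):
  `∑_{n≤x} f(n) n^{iα} = x^{iα}/(1+iα) ∑_{n≤x} f(n) + O((x/log x) log(e+|α|) exp(∑_{p≤x} |1-f(p)|/p))`.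
  PROVED downstream: `GranvilleSoundararajan2003_lemma71_holds` (`GranvilleSoundararajanLemma71.lean`).
* `GranvilleSoundararajan2003_theorem3` — NAMED FACT (Theorem 3): with `T = log x` and `y₀` any
  maximiser of `|F(1+iy)|` on `|y| ≤ 2T`, `x⁻¹|∑_{n≤x} f(n)| ≪ 1/(1+|y₀|) + (log log x)^{1+2(1-2/π)}/(log x)^{1-2/π}`.
  PROVED downstream: `GranvilleSoundararajan2003_theorem3_holds` (`GranvilleSoundararajanTheorem3Proofs.lean`).
* `GranvilleSoundararajan2003_corollary3` — NAMED FACT (Corollary 3, Lipschitz behaviour of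
  `|x⁻¹ ∑_{n≤x} f(n)|`), recorded for `x ≥ x₀` and `1 ≤ w ≤ √x` (the printed `1 ≤ w ≤ x/10` over-claims
  — see the docstring):
  `| |x⁻¹ ∑_{n≤x} f(n)| - (w/x)|∑_{n≤x/w} f(n)| | ≪ (log 2w/log x)^{1-2/π} log(log x/log 2w) + log log x/(log x)^{2-√3}`.
  PROVED downstream: `GranvilleSoundararajan2003_corollary3_holds` (`GranvilleSoundararajanCorollary3Holds.lean`).
* `GranvilleSoundararajan2003_theorem4_central` — NAMED FACT (Theorem 4, the twisted Lipschitz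
  estimate, **in the form established by its printed proof, §6**): for `x ≥ x₀`, `1 ≤ w ≤ √x` and
  maximisers `y₀` (of `|F(1+iy)|` over `|y| ≤ 2 log x`) lying in the central half `|y₀| ≤ log x`,
  `|x⁻¹ ∑_{n≤x} f(n) n^{-iy₀} - (w/x) ∑_{n ≤ x/w} f(n) n^{-iy₀}| ≪ (log 2w/log x)^{1-2/π} log(log x/log 2w)
   + (log log x)^{1+2(1-2/π)}/(log x)^{1-2/π}`.
  This is the corrected restatement of the printed Theorem 4 (whose text over-claims twice, see
  below) and the statement consumers take.  PROVED downstream: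
  `GranvilleSoundararajan2003_theorem4_central_holds` (`GranvilleSoundararajanTheorem4Proofs.lean`, on
  `GranvilleSoundararajanTheorem4Window.lean`: Proposition 3.3, (2.2), (2.6), Lemma 2.3, (6.2)–(6.5)).
* **Deprecated renderings of Theorem 4** (last section of the file; verdict clean-up 2026-08-15:
  `@[deprecated GranvilleSoundararajan2003_theorem4_central …]`, statements kept byte-for-byte as
  the literal record of the printed text and as the subjects of their refutations — never take them
  as hypotheses):
  `GranvilleSoundararajan2003_theorem4` — Theorem 4 exactly as printed (`x ≥ 3`, `1 ≤ w ≤ x/10`, every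
  maximiser `y₀ ∈ [-2 log x, 2 log x]`); false near `w ≍ x` by a discretisation effect; REFUTED in
  tree: `GranvilleSoundararajan2003_theorem4_false` (`GranvilleSoundararajan2003Theorem4Refutation.lean`,
  witness `f = 1`, `y₀ = 0`, `w = x/10`).
  `GranvilleSoundararajan2003_theorem4_sqrtRange` — the same with the ranges repaired (`x ≥ x₀`,
  `1 ≤ w ≤ √x`) but still asserted for every maximiser; false for maximisers at the EDGE of the
  window; REFUTED in tree: `GranvilleSoundararajan2003_theorem4_sqrtRange_false`
  (`GranvilleSoundararajan2003Theorem4EdgeRefutation.lean`, witness `f(n) = n^{iu}`,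
  `u = -2 log x - (log x)^{-3/4}`, `w = exp(π/(y₀ - u))`).
  The bridge `GranvilleSoundararajan2003_theorem4_central_of_sqrtRange` (`sqrtRange → central`),
  vacuous once its hypothesis was refuted and unused in the tree, was removed in the same clean-up
  (the conclusion is proved outright, `GranvilleSoundararajan2003_theorem4_central_holds`).

## Faithfulness notes

* "multiplicative function `f` with `|f(n)| ≤ 1` for all `n`" (complex-valued) is rendered
  `f : ArithmeticFunction ℂ`, `f.IsMultiplicative`, `∀ n, ‖f n‖ ≤ 1` (as for
  `Literature.NumberTheory.Sieve.halaszMontgomeryTenenbaum`); `∑_{n ≤ x}` is `∑_{n ∈ Icc 1 ⌊x⌋₊}` and `∑_{n ≤ x/w}` is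
  `∑_{n ∈ Icc 1 ⌊x/w⌋₊}`; `p ≤ x` ranges over `Nat.primesBelow (⌊x⌋₊ + 1)`.
* `max_{|y| ≤ 2T} |F(1+iy)|` is a maximum of a continuous function on a compact interval; it is
  rendered as `sSup` of the image of `Set.Icc (-2T) (2T)` (Theorem 1) and, in Theorems 3 and 4
  ("suppose that the maximum in (1.3) occurs at `y₀`", `T = log x`), by quantifying over maximisers:
  every `y₀ ∈ [-2T, 2T]` with `|F(1+iy)| ≤ |F(1+iy₀)|` for all `|y| ≤ 2T` (such `y₀` exist by continuity
  and compactness) — all of them in Theorem 3, those of the central half `|y₀| ≤ T` in Theorem 4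
  (the case its printed proof establishes; the every-maximiser reading is refuted, see above).
* "`≪`", "`O(·)`" are absolute (independent of `f, x, T, w, y, β`): `∃ C` outermost; the explicit main
  term of Theorem 1 is kept as printed (`γ` = `Real.eulerMascheroniConstant`).  The printed ranges
  `x ≥ 3`, `T ≥ 1`, `1/log x ≤ |β| ≤ log x` are kept; for `x ≥ 3` one has `log log x > 0`, so the real
  powers `(log log x)^{…}` are powers of a positive number.  For Theorem 4 and Corollary 3 the printed
  range `1 ≤ w ≤ x/10` over-claims (see their docstrings); they are recorded for `x ≥ x₀`, `1 ≤ w ≤ √x`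
  (`∃ C x₀`), the range on which §6–§7 of the paper establish them ("We may suppose that `w ≤ √x`,
  else there's nothing to prove", arXiv p. 10).

## References

* A. Granville, K. Soundararajan, *Decay of mean values of multiplicative functions*, Canad. J.
  Math. 55 (2003), no. 6, 1191–1230, doi:10.4153/CJM-2003-047-0; arXiv:math/9911246 — Theorem 1
  and (1.2)–(1.3) (arXiv p. 1), Theorems 3, 4 and Corollary 3 (arXiv p. 2), Lemma 2.3 (arXiv p. 5),
  §5–§6 (proofs of Theorems 3, 4, arXiv p. 9), Lemma 7.1 and §7 (deduction of Corollary 3, arXiv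
  pp. 9–10).
* A. Granville, A. J. Harper, K. Soundararajan, *A new proof of Halász's theorem, and its
  consequences*, Compositio Math. 155 (2019), 126–163, Theorem 1.5 (the modern form of Theorem 4,
  normalised by `x^{-1-it₁}` outside the sum; cited for comparison only).

## How Lemma 4 of Matomäki–Radziwiłł follows (plan; real `f`, `X/4 ≤ Y ≤ X`, `w = X/Y ≤ 4`)

Corollary 3 (with `w = X/Y ≤ 4 ≤ √X`) gives `||S(X)|/X - |S(Y)|/Y| ≪ (log X)^{-1/4}` (`S(Z) = ∑_{n≤Z} f(n)`), which settles the case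
of equal signs; for opposite signs one shows `|S(X)|/X ≪ (log X)^{-1/4}`: if the maximiser has
`|y₀| ≥ (log X)/2` by Theorem 3; if `1/100 ≤ |y₀| ≤ (log X)/2` by Lemma 2.3 at `(y, β) = (-y₀, 2y₀)`
(`F(1-iy₀) = conj F(1+iy₀)` for real `f`) and Theorem 1; if `|y₀| < 1/100`, by Halász
(`Literature.NumberTheory.Sieve.halaszMontgomeryTenenbaum`) when `M = ∑_{p≤X}(1 - Re f(p)p^{-iy₀})/p ≥ (2-√3) log log X`, and
otherwise by Theorem 4 (`w ≤ 4 ≤ √X`, `|y₀| < 1/100 ≤ log X`: the central form suffices), Lemma 7.1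
(applied to `f(n)n^{-iy₀}`, whose `∑_p |1 - f(p)p^{-iy₀}|/p` is `≤ (√3-1) log log X + O(1)` by
Cauchy–Schwarz) and `|X^{iy₀} - Y^{iy₀}| ≤ |y₀| log 4`, which give
`|S(X)/X - S(Y)/Y| ≤ 0.02 |S(Y)|/Y + O((log X)^{-1/4})` (Matomäki–Radziwiłł's sign argument).  This plan
is carried out in `Literature/NumberTheory/Sieve/MatomakiRadziwillLemma4LipschitzCentral.lean` and
`…LipschitzOfCentral4.lean` (`MatomakiRadziwill2016_lemma4_holds`, `MatomakiRadziwillTheorem3VK.lean`).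
* K. Matomäki, M. Radziwiłł, *Multiplicative functions in short intervals*, Ann. of Math. (2) 183
  (2016), §3, Lemmas 1, 2 and 4 (the consumers).
-/

noncomputable section

open Finset Filter Complex

namespace Literature.NumberTheory.LFunctions.GranvilleSoundararajan

/-- The local Euler factor `∑_{k ≥ 0} f(p^k) p^{-ks}` (`= 1 + f(p)/p^s + f(p²)/p^{2s} + …` when
`f(1) = 1`). [cite: GranvilleSoundararajan2003, Theorem 1 (definition of F)] -/
def eulerFactor (f : ℕ → ℂ) (p : ℕ) (s : ℂ) : ℂ :=
  ∑' k : ℕ, f (p ^ k) * (p : ℂ) ^ (-(s * k))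

/-- `F(s) = ∏_{p ≤ x} (1 + f(p)/p^s + f(p²)/p^{2s} + …)`, the Euler product truncated at the primes
`p ≤ x` (all prime powers kept), GS03 Theorem 1. [cite: GranvilleSoundararajan2003, Theorem 1 (definition of F)] -/
def truncEulerProduct (f : ℕ → ℂ) (x : ℝ) (s : ℂ) : ℂ :=
  ∏ p ∈ Nat.primesBelow (⌊x⌋₊ + 1), eulerFactor f p s

/-- `L(x, T)·log x = max_{|y| ≤ 2T} |F(1+iy)|` ((1.3) of GS03), as the supremum of the continuous
function `y ↦ |F(1+iy)|` over the compact interval `[-2T, 2T]`. [cite: GranvilleSoundararajan2003, (1.3)] -/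
def maxModulus (f : ℕ → ℂ) (x T : ℝ) : ℝ :=
  sSup ((fun y : ℝ => ‖truncEulerProduct f x (1 + y * I)‖) '' Set.Icc (-(2 * T)) (2 * T))

/-- The terms of the Euler factor are dominated by a geometric series: for `‖f‖ ≤ 1`, `p ≥ 2` and
`σ = Re s > 0`, `‖f(p^k) p^{-ks}‖ ≤ (p^{-σ})^k`. [folklore] -/
theorem norm_term_le {f : ℕ → ℂ} (hf : ∀ n, ‖f n‖ ≤ 1) {p : ℕ} (hp : 2 ≤ p) (s : ℂ) (k : ℕ) :
    ‖f (p ^ k) * (p : ℂ) ^ (-(s * k))‖ ≤ ((p : ℝ) ^ (-s.re)) ^ k := by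
  have hp0 : (0 : ℝ) < p := by exact_mod_cast (zero_lt_two.trans_le hp)
  rw [norm_mul]
  have h1 : ‖(p : ℂ) ^ (-(s * k))‖ = ((p : ℝ) ^ (-s.re)) ^ k := by
    rw [show (p : ℂ) = ((p : ℝ) : ℂ) by simp, Complex.norm_cpow_eq_rpow_re_of_pos hp0,
      ← Real.rpow_natCast, ← Real.rpow_mul hp0.le]
    congr 1
    simp [Complex.mul_re]
  rw [h1]
  exact mul_le_of_le_one_left (by positivity) (hf _)

/-- The Euler factor converges absolutely for `Re s > 0` when `|f| ≤ 1`. [folklore] -/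
theorem summable_eulerFactor {f : ℕ → ℂ} (hf : ∀ n, ‖f n‖ ≤ 1) {p : ℕ} (hp : 2 ≤ p) {s : ℂ}
    (hs : 0 < s.re) : Summable fun k : ℕ => f (p ^ k) * (p : ℂ) ^ (-(s * k)) := by
  have hp1 : (1 : ℝ) < p := by exact_mod_cast hp
  have hr : (p : ℝ) ^ (-s.re) < 1 := Real.rpow_lt_one_of_one_lt_of_neg hp1 (by linarith)
  have hr0 : 0 ≤ (p : ℝ) ^ (-s.re) := Real.rpow_nonneg (by positivity) _
  refine Summable.of_norm_bounded (g := fun k : ℕ => ((p : ℝ) ^ (-s.re)) ^ k)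
    (summable_geometric_of_lt_one hr0 hr) (norm_term_le hf hp s)

/-- For `f(1) = 1` the Euler factor is `1 + ∑_{k ≥ 1} f(p^k) p^{-ks}`, as printed. [folklore] -/
theorem eulerFactor_eq_one_add {f : ℕ → ℂ} (hf : ∀ n, ‖f n‖ ≤ 1) (hf1 : f 1 = 1) {p : ℕ}
    (hp : 2 ≤ p) {s : ℂ} (hs : 0 < s.re) :
    eulerFactor f p s = 1 + ∑' k : ℕ, f (p ^ (k + 1)) * (p : ℂ) ^ (-(s * (k + 1 : ℕ))) := by
  rw [eulerFactor, (summable_eulerFactor hf hp hs).tsum_eq_zero_add]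
  simp [hf1]

/-- NAMED FACT — **Granville–Soundararajan 2003, Theorem 1** (the sharp form of Halász's theorem), as
printed: "Let `f` be a multiplicative function with `|f(n)| ≤ 1` for all `n`. Let `x ≥ 3`, and let `T ≥ 1`
be real numbers. Put for any complex number `s` with `Re(s) > 0`,
`F(s) = ∏_{p ≤ x} (1 + f(p)/p^s + f(p²)/p^{2s} + …)`, and let `L = L(x,T) = (1/log x)(max_{|y| ≤ 2T} |F(1+iy)|)`.
Then `(1/x)|∑_{n ≤ x} f(n)| ≤ L(log(e^γ/L) + 12/7) + O(1/T + log log x/log x)`."  The `O`-constant is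
absolute (`∃ C`); `γ` is Euler's constant; `L = maxModulus f x T / log x`.
Users take `(h : GranvilleSoundararajan2003_theorem1)`. [cite: GranvilleSoundararajan2003, Theorem 1] -/
def GranvilleSoundararajan2003_theorem1 : Prop :=
  ∃ C : ℝ, ∀ f : ArithmeticFunction ℂ, f.IsMultiplicative → (∀ n, ‖f n‖ ≤ 1) →
    ∀ x T : ℝ, 3 ≤ x → 1 ≤ T →
      ‖∑ n ∈ Icc 1 ⌊x⌋₊, f n‖ / x ≤
        (maxModulus f x T / Real.log x) *
            (Real.log (Real.exp Real.eulerMascheroniConstant / (maxModulus f x T / Real.log x)) + 12 / 7)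
          + C * (1 / T + Real.log (Real.log x) / Real.log x)

/-- NAMED FACT — **Granville–Soundararajan 2003, Lemma 2.3**, as printed: "Let `f`, `x`, and `F` be as
in Theorem 1. Then for all real numbers `y`, and `1/log x ≤ |β| ≤ log x`, we have
`|F(1+iy) F(1+i(y+β))| ≪ (log x)^{4/π} max(1/|β|, (log log x)²)^{2(1-2/π)}`."  Absolute implied
constant (`∃ C`).  (For real `f`, `F(1 - it) = conj F(1 + it)`, so `y = -t`, `β = 2t` bounds
`|F(1+it)|²`: this is the lower bound for the pretentious distance at `|t| ≥ 1/100` used in the proof of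
Lemma 4 of Matomäki–Radziwiłł.)
Users take `(h : GranvilleSoundararajan2003_lemma23)`. [cite: GranvilleSoundararajan2003, Lemma 2.3] -/
def GranvilleSoundararajan2003_lemma23 : Prop :=
  ∃ C : ℝ, ∀ f : ArithmeticFunction ℂ, f.IsMultiplicative → (∀ n, ‖f n‖ ≤ 1) →
    ∀ x : ℝ, 3 ≤ x → ∀ y β : ℝ, 1 / Real.log x ≤ |β| → |β| ≤ Real.log x →
      ‖truncEulerProduct f x (1 + y * I) * truncEulerProduct f x (1 + (y + β) * I)‖ ≤
        C * Real.log x ^ (4 / Real.pi) *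
          (max (1 / |β|) (Real.log (Real.log x) ^ 2)) ^ (2 * (1 - 2 / Real.pi))

/-- NAMED FACT — **Granville–Soundararajan 2003, Lemma 7.1**, as printed: "Suppose `f(n)` is a
multiplicative function with `|f(n)| ≤ 1` for all `n`. Then for any real number `α` we have
`∑_{n ≤ x} f(n) n^{iα} = x^{iα}/(1+iα) ∑_{n ≤ x} f(n) + O((x/log x) log(e+|α|) exp(∑_{p ≤ x} |1-f(p)|/p))`."
Absolute implied constant (`∃ C`); `x ≥ 3` (the standing assumption of the paper, making `log x > 0`).
Users take `(h : GranvilleSoundararajan2003_lemma71)`. [cite: GranvilleSoundararajan2003, Lemma 7.1] -/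
def GranvilleSoundararajan2003_lemma71 : Prop :=
  ∃ C : ℝ, ∀ f : ArithmeticFunction ℂ, f.IsMultiplicative → (∀ n, ‖f n‖ ≤ 1) →
    ∀ x : ℝ, 3 ≤ x → ∀ α : ℝ,
      ‖∑ n ∈ Icc 1 ⌊x⌋₊, f n * (n : ℂ) ^ (α * I)
          - (x : ℂ) ^ (α * I) / (1 + α * I) * ∑ n ∈ Icc 1 ⌊x⌋₊, f n‖ ≤
        C * (x / Real.log x) * Real.log (Real.exp 1 + |α|)
          * Real.exp (∑ p ∈ Nat.primesBelow (⌊x⌋₊ + 1), ‖1 - f p‖ / p)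

/-- NAMED FACT — **Granville–Soundararajan 2003, Theorem 3**, as printed: "Let `f` be a multiplicative
function with `|f(n)| ≤ 1` for all `n`. Take `T = log x` in Theorem 1, and suppose the maximum in (1.3) is
attained at `y = y₀`. Then `(1/x)|∑_{n ≤ x} f(n)| ≪ 1/(1+|y₀|) + (log log x)^{1+2(1-2/π)}/(log x)^{1-2/π}`."
Absolute implied constant (`∃ C`); `x ≥ 3` as in Theorem 1; "the maximum in (1.3) is attained at `y₀`"
= `y₀ ∈ [-2 log x, 2 log x]` and `‖F(1+iy)‖ ≤ ‖F(1+iy₀)‖` for all `|y| ≤ 2 log x` (such `y₀` exist by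
continuity and compactness; the statement is asserted for every maximiser, which is harmless here —
the left side does not depend on `y₀`).  PROVED downstream: `GranvilleSoundararajan2003_theorem3_holds`
(`GranvilleSoundararajanTheorem3Proofs.lean`).
Users take `(h : GranvilleSoundararajan2003_theorem3)`. [cite: GranvilleSoundararajan2003, Theorem 3] -/
def GranvilleSoundararajan2003_theorem3 : Prop :=
  ∃ C : ℝ, ∀ f : ArithmeticFunction ℂ, f.IsMultiplicative → (∀ n, ‖f n‖ ≤ 1) →
    ∀ x : ℝ, 3 ≤ x → ∀ y₀ : ℝ, |y₀| ≤ 2 * Real.log x →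
      (∀ y : ℝ, |y| ≤ 2 * Real.log x →
        ‖truncEulerProduct f x (1 + y * I)‖ ≤ ‖truncEulerProduct f x (1 + y₀ * I)‖) →
      ‖∑ n ∈ Icc 1 ⌊x⌋₊, f n‖ / x ≤
        C * (1 / (1 + |y₀|)
          + Real.log (Real.log x) ^ (1 + 2 * (1 - 2 / Real.pi)) / Real.log x ^ (1 - 2 / Real.pi))

/-- NAMED FACT — **Granville–Soundararajan 2003, Corollary 3**, for `x` large and `1 ≤ w ≤ √x`.
Printed: "Let `f` be a multiplicative function with `|f(n)| ≤ 1` for all `n`. Then for `1 ≤ w ≤ x/10`, we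
have `(1/x)|∑_{n ≤ x} f(n)| - (w/x)|∑_{n ≤ x/w} f(n)| ≪ (log 2w/log x)^{1-2/π} log(log x/log 2w) + log log x/(log x)^{2-√3}`"
(`≪` with an absolute constant; being Vinogradov notation it bounds the absolute value of the left side,
which is how it is recorded and how Matomäki–Radziwiłł use it: "`||X⁻¹∑_{n≤X} f| - |Y⁻¹∑_{n≤Y} f|| ≪ (log X)^{-1/4}`").
**Deliberate deviation from the printed ranges, flagged:** the fact is recorded for `x ≥ x₀` (some
absolute `x₀`, `∃ C x₀`) and `1 ≤ w ≤ √x` only.  Reason (found in review): on the printed range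
`1 ≤ w ≤ x/10` the statement is false near `w ≍ x` — for `f = ζ`, `x = m ∈ ℕ`, `w = m/10.5` the left side
is `|1 - 10/10.5| = 1/21` while the right side tends to `0`, its main term `log(log x/log 2w)` vanishing
as `w → x/const` (a discretisation effect); the paper's deduction of the corollary (§7, arXiv p. 10) opens
with "We may suppose that `w ≤ √x`, else there's nothing to prove", and for bounded `x` the printed
right-hand side can even be negative (e.g. `x = 3`, `w = 1.73`), whence the "`x` large" proviso.  The
consumer (`MatomakiRadziwill2016_lemma4_lipschitz`) uses `w ≤ 4 ≤ √x` with `x → ∞`.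
Users take `(h : GranvilleSoundararajan2003_corollary3)`. [cite: GranvilleSoundararajan2003, Corollary 3 and §7] -/
def GranvilleSoundararajan2003_corollary3 : Prop :=
  ∃ C x₀ : ℝ, ∀ f : ArithmeticFunction ℂ, f.IsMultiplicative → (∀ n, ‖f n‖ ≤ 1) →
    ∀ x w : ℝ, x₀ ≤ x → 1 ≤ w → w ≤ Real.sqrt x →
      |‖∑ n ∈ Icc 1 ⌊x⌋₊, f n‖ / x - w / x * ‖∑ n ∈ Icc 1 ⌊x / w⌋₊, f n‖| ≤
        C * ((Real.log (2 * w) / Real.log x) ^ (1 - 2 / Real.pi)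
                * Real.log (Real.log x / Real.log (2 * w))
              + Real.log (Real.log x) / Real.log x ^ (2 - Real.sqrt 3))

/-- NAMED FACT — **Granville–Soundararajan 2003, Theorem 4** (the twisted Lipschitz estimate) **as
established by its printed proof (§6)**: for `x ≥ x₀`, `1 ≤ w ≤ √x`, and maximisers `y₀` lying in the
central half `|y₀| ≤ log x` of the window.  This is the corrected restatement of the printed Theorem 4,
whose two literal renderings `GranvilleSoundararajan2003_theorem4` (printed ranges, every maximiser)
and `GranvilleSoundararajan2003_theorem4_sqrtRange` (repaired ranges, every maximiser) are both REFUTED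
in tree and `@[deprecated]` (last section of this file), and it is the statement consumers take
(`(h : GranvilleSoundararajan2003_theorem4_central)`; the consumer in the tree,
`Literature.NumberTheory.Sieve.MatomakiRadziwillL4A.lipschitz_of_GS_central`, applies Theorem 4 only
to maximisers with `|y₀| < 1/100` and `w ≤ 4`).  **PROVED downstream:**
`GranvilleSoundararajan2003_theorem4_central_holds` (`GranvilleSoundararajanTheorem4Proofs.lean`).
Printed (arXiv p. 2): "Let `f`, `x`, and `F` be as in Theorem 1. Take `T = log x`, and suppose that the
maximum in (1.3) occurs at `y₀`. Then for `1 ≤ w ≤ x/10`, we have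
`|(1/x) ∑_{n ≤ x} f(n) n^{-iy₀} - (w/x) ∑_{n ≤ x/w} f(n) n^{-iy₀}|
 ≪ (log 2w/log x)^{1-2/π} log(log x/log 2w) + (log log x)^{1+2(1-2/π)}/(log x)^{1-2/π}`."
Absolute implied constant (`∃ C`); `f : ArithmeticFunction ℂ` multiplicative with `‖f n‖ ≤ 1`;
"the maximum in (1.3) (with `T = log x`) occurs at `y₀`" = `‖F(1+iy)‖ ≤ ‖F(1+iy₀)‖` for all
`|y| ≤ 2 log x`.
**Deliberate deviations from the printed statement, flagged.**
(1) Ranges `x ≥ x₀` (`∃ C x₀`) and `1 ≤ w ≤ √x` instead of `x ≥ 3`, `1 ≤ w ≤ x/10`: on the rest of the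
printed `w`-range the statement is false by a discretisation effect (`f = 1`, `w = x/10`:
`GranvilleSoundararajan2003_theorem4_false`), and for bounded `x` the printed right-hand side can be
negative (`x = 3`, `w = 1.73`); §7 of the paper itself opens "We may suppose that `w ≤ √x`".
(2) The maximiser is restricted to `|y₀| ≤ log x`: for maximisers at the edge of `|y| ≤ 2 log x` the
statement is false (`f(n) = n^{iu}`, `u = -2 log x - (log x)^{-3/4}`, `w = exp(π/(y₀ - u))`:
`GranvilleSoundararajan2003_theorem4_sqrtRange_false`).  What §6 (arXiv p. 9) proves is exactly this
case: its opening reduction "If `|y₀| ≥ (log x)/2`, then in view of Theorem 3, the result follows" is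
valid only for untwisted means, and the remainder — (6.1) `|F₀(1)| = max_{|y| ≤ log x} |F₀(1+iy)|` for
`F₀(s) = F(s + iy₀)`, whose printed one-line proof uses precisely `|y| + |y₀| ≤ 2 log x`, then
Proposition 3.3 with `T = (log x)/2`, (2.6) of Lemma 2.2, Lemma 2.3 and the trivial bounds
(6.2)–(6.5) — uses nothing else about `y₀`; the final `α`-integration gives
`≪ (M/log x)^{1-2/π}(1 + log(log x/M))` with `M = max(log 2w, (log log x)²)`, which is the printed
right-hand side because `log(log x/log 2w) ≥ log(2 - o(1))` for `w ≤ √x`.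
Users take `(h : GranvilleSoundararajan2003_theorem4_central)` and feed it
`GranvilleSoundararajan2003_theorem4_central_holds`.
[cite: GranvilleSoundararajan2003, Theorem 4 (arXiv p. 2) and §6, (6.1)–(6.5) (arXiv p. 9)] -/
def GranvilleSoundararajan2003_theorem4_central : Prop :=
  ∃ C x₀ : ℝ, ∀ f : ArithmeticFunction ℂ, f.IsMultiplicative → (∀ n, ‖f n‖ ≤ 1) →
    ∀ x : ℝ, x₀ ≤ x → ∀ y₀ : ℝ, |y₀| ≤ Real.log x →
      (∀ y : ℝ, |y| ≤ 2 * Real.log x →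
        ‖truncEulerProduct f x (1 + y * I)‖ ≤ ‖truncEulerProduct f x (1 + y₀ * I)‖) →
      ∀ w : ℝ, 1 ≤ w → w ≤ Real.sqrt x →
        ‖(x : ℂ)⁻¹ * ∑ n ∈ Icc 1 ⌊x⌋₊, f n * (n : ℂ) ^ (-(y₀ * I))
            - ((w / x : ℝ) : ℂ) * ∑ n ∈ Icc 1 ⌊x / w⌋₊, f n * (n : ℂ) ^ (-(y₀ * I))‖ ≤
          C * ((Real.log (2 * w) / Real.log x) ^ (1 - 2 / Real.pi)
                  * Real.log (Real.log x / Real.log (2 * w))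
                + Real.log (Real.log x) ^ (1 + 2 * (1 - 2 / Real.pi)) / Real.log x ^ (1 - 2 / Real.pi))

/-! ### Deprecated renderings of Theorem 4 (verdict clean-up 2026-08-15)

Both declarations below are FALSE as stated and formally refuted in tree; they are kept byte-for-byte,
`@[deprecated GranvilleSoundararajan2003_theorem4_central …]`, only as the literal record of the printed
text and as the subjects of their refutations (`GranvilleSoundararajan2003_theorem4_false`,
`GranvilleSoundararajan2003Theorem4Refutation.lean`; `GranvilleSoundararajan2003_theorem4_sqrtRange_false`,
`GranvilleSoundararajan2003Theorem4EdgeRefutation.lean`), which must name them.  Never take either as a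
hypothesis (it is refutable, so anything follows); the statement to use is
`GranvilleSoundararajan2003_theorem4_central`, proved as `GranvilleSoundararajan2003_theorem4_central_holds`. -/

/-- **DEPRECATED — mis-stated (printed ranges) and REFUTED rendering** of **Granville–Soundararajan
2003, Theorem 4** (the twisted Lipschitz estimate); verdict clean-up 2026-08-15.  Printed (arXiv p. 2):
"Let `f`, `x`, and `F` be as in Theorem 1. Take `T = log x`, and suppose that the maximum in (1.3)
occurs at `y₀`. Then for `1 ≤ w ≤ x/10`, we have
`|(1/x) ∑_{n ≤ x} f(n) n^{-iy₀} - (w/x) ∑_{n ≤ x/w} f(n) n^{-iy₀}|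
 ≪ (log 2w/log x)^{1-2/π} log(log x/log 2w) + (log log x)^{1+2(1-2/π)}/(log x)^{1-2/π}`."  This
declaration renders that text literally: absolute implied constant (`∃ C`), `x ≥ 3` (as in Theorem 1),
`1 ≤ w ≤ x/10`, and "the maximum occurs at `y₀`" = every `y₀ ∈ [-2 log x, 2 log x]` with
`‖F(1+iy)‖ ≤ ‖F(1+iy₀)‖` for all `|y| ≤ 2 log x`.
**What is wrong with it.** (i) On the printed range `1 ≤ w ≤ x/10` the statement is false near `w ≍ x`
by a discretisation effect: the main term `(log 2w/log x)^{1-2/π} log(log x/log 2w)` vanishes as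
`log 2w/log x → 1`, while the left side keeps a term of size `≍ (w/x)·frac(x/w)`.  **Refuted in tree
(negation proved):** `GranvilleSoundararajan2003_theorem4_false : ¬ GranvilleSoundararajan2003_theorem4`
(`GranvilleSoundararajan2003Theorem4Refutation.lean`; witness `f = 1`, the Dirichlet identity, for which
`F ≡ 1` and `y₀ = 0` is a maximiser, and `w = x/10`: the left side is `|1/x - 1/10| ≥ 1/20` for
`x ≥ 20`, the right side tends to `0`).  The paper's own deduction of Corollary 3 (§7, arXiv p. 10)
opens "We may suppose that `w ≤ √x`, else there's nothing to prove", and the bounds of §6 establish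
the estimate where `log(log x/log 2w)` dominates, i.e. for `w ≤ √x` and `x` large (for bounded `x` the
printed right-hand side can even be negative, e.g. `x = 3`, `w = 1.73`).  (ii) Even for `w ≤ √x` the
every-maximiser reading fails for maximisers `y₀` at the EDGE of the window `|y| ≤ 2 log x`
(`GranvilleSoundararajan2003_theorem4_sqrtRange_false`, below): the printed proof (§6, arXiv p. 9)
establishes the estimate for central maximisers `|y₀| ≤ log x` only (its display (6.1) needs
`|y| + |y₀| ≤ 2 log x`).
**Corrected statement:** `GranvilleSoundararajan2003_theorem4_central` (above: `x ≥ x₀`, `1 ≤ w ≤ √x`,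
`|y₀| ≤ log x`), PROVED in tree: `GranvilleSoundararajan2003_theorem4_central_holds`
(`GranvilleSoundararajanTheorem4Proofs.lean`).  The statement below is unchanged, kept only as the
literal record and as the subject of its refutation; never take `(h : GranvilleSoundararajan2003_theorem4)`
as a hypothesis (anything follows) — every use of the name now raises a deprecation warning pointing at
the corrected fact.
[cite: GranvilleSoundararajan2003, Theorem 4 (arXiv p. 2) as printed — refuted in tree (GranvilleSoundararajan2003_theorem4_false); corrected as GranvilleSoundararajan2003_theorem4_central] -/
@[deprecated GranvilleSoundararajan2003_theorem4_central "mis-stated (printed ranges `x ≥ 3`, \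
  `1 ≤ w ≤ x/10`, every maximiser) and refuted by \
  Literature.NumberTheory.LFunctions.GranvilleSoundararajan.GranvilleSoundararajan2003_theorem4_false \
  (GranvilleSoundararajan2003Theorem4Refutation.lean); use GranvilleSoundararajan2003_theorem4_central \
  (proved: GranvilleSoundararajan2003_theorem4_central_holds, GranvilleSoundararajanTheorem4Proofs.lean)"
  (since := "2026-08-15")]
def GranvilleSoundararajan2003_theorem4 : Prop :=
  ∃ C : ℝ, ∀ f : ArithmeticFunction ℂ, f.IsMultiplicative → (∀ n, ‖f n‖ ≤ 1) →
    ∀ x : ℝ, 3 ≤ x → ∀ y₀ : ℝ, |y₀| ≤ 2 * Real.log x →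
      (∀ y : ℝ, |y| ≤ 2 * Real.log x →
        ‖truncEulerProduct f x (1 + y * I)‖ ≤ ‖truncEulerProduct f x (1 + y₀ * I)‖) →
      ∀ w : ℝ, 1 ≤ w → w ≤ x / 10 →
        ‖(x : ℂ)⁻¹ * ∑ n ∈ Icc 1 ⌊x⌋₊, f n * (n : ℂ) ^ (-(y₀ * I))
            - ((w / x : ℝ) : ℂ) * ∑ n ∈ Icc 1 ⌊x / w⌋₊, f n * (n : ℂ) ^ (-(y₀ * I))‖ ≤
          C * ((Real.log (2 * w) / Real.log x) ^ (1 - 2 / Real.pi)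
                  * Real.log (Real.log x / Real.log (2 * w))
                + Real.log (Real.log x) ^ (1 + 2 * (1 - 2 / Real.pi)) / Real.log x ^ (1 - 2 / Real.pi))

/-- **DEPRECATED — REFUTED rendering** of **Granville–Soundararajan 2003, Theorem 4** (the twisted
Lipschitz estimate) on the repaired ranges `x ≥ x₀`, `1 ≤ w ≤ √x`, but — as printed — for EVERY
maximiser `y₀ ∈ [-2 log x, 2 log x]`; verdict clean-up 2026-08-15.  Printed (arXiv p. 2): "Let `f`, `x`,
and `F` be as in Theorem 1. Take `T = log x`, and suppose that the maximum in (1.3) occurs at `y₀`. Then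
for `1 ≤ w ≤ x/10`, we have
`|(1/x) ∑_{n ≤ x} f(n) n^{-iy₀} - (w/x) ∑_{n ≤ x/w} f(n) n^{-iy₀}|
 ≪ (log 2w/log x)^{1-2/π} log(log x/log 2w) + (log log x)^{1+2(1-2/π)}/(log x)^{1-2/π}`."  Absolute
implied constant; ranges `x ≥ x₀` (`∃ C x₀`) and `1 ≤ w ≤ √x` (the printed `x ≥ 3`, `w ≤ x/10`
over-claim: `GranvilleSoundararajan2003_theorem4_false`); the maximiser quantified as every
`y₀ ∈ [-2 log x, 2 log x]` with `‖F(1+iy)‖ ≤ ‖F(1+iy₀)‖` for all `|y| ≤ 2 log x`.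
**What is wrong with it.** The statement is false for maximisers at the EDGE of the window.  Witness
(found 2026-08-15 while attempting the discharge): `L = log x` large, `δ = L^{-3/4}`, `f(n) = n^{iu}`
with `u = -2L - δ` (completely multiplicative, `|f| = 1`); then `F(1+iy) = ζ_x(1+i(y-u))` with
`ζ_x(s) = ∏_{p ≤ x}(1 - p^{-s})^{-1}` and `t = y - u ∈ [δ, 4L+δ]` on the window; Mertens' theorem with
remainder gives `e^{-c}/t ≤ |ζ_x(1+it)| ≤ e^{c}/t` for `δ ≤ t ≤ 1` and `|ζ_x(1+it)| ≪ t^{1/10}` for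
`1 ≤ t ≤ 5L`, so every maximiser has `t* := y₀ - u ∈ [δ, Kδ]` (`K` absolute), i.e. lies within `Kδ` of
the edge `-2L`; the twisted sums are `∑_{n ≤ z} n^{-it*} = z^{1-it*}/(1-it*) + O(1 + t* log z)`, and for
`w = exp(π/t*)` (`≤ exp(π L^{3/4}) ≤ √x`) the left side is `|1 - w^{it*}|/|1-it*| + o(1) → 2`, whereas
the right side is `≪ L^{-(1-2/π)/4} log L + (log L)^{1+2(1-2/π)} L^{-(1-2/π)} → 0`.  **Refuted in tree
(negation proved):**
`GranvilleSoundararajan2003_theorem4_sqrtRange_false : ¬ GranvilleSoundararajan2003_theorem4_sqrtRange`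
(`GranvilleSoundararajan2003Theorem4EdgeRefutation.lean`, along these lines).  What the printed proof
(§6, arXiv p. 9) establishes is the estimate for maximisers in the CENTRAL half `|y₀| ≤ log x`: its
display (6.1), `|F₀(1)| = max_{|y| ≤ log x}|F₀(1+iy)|` with `F₀(s) = F(s+iy₀)`, needs
`|y| + |y₀| ≤ 2 log x`, and the rest of §6 uses nothing else about `y₀`, while its opening sentence
("If `|y₀| ≥ (log x)/2`, then in view of Theorem 3, the result follows") does not apply to TWISTED
means (for `f(n) = n^{iu}` both have modulus `≍ 1`).  The modern form of the result
(Granville–Harper–Soundararajan, Compositio Math. 155 (2019), Thm 1.5, `κ = 1`) normalises outside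
the sum, `x^{-1-it₁} ∑_{n≤x} f(n)` with `t₁` a maximiser over `|t| ≤ log x`, and is immune to the
example.
**Corrected statement:** `GranvilleSoundararajan2003_theorem4_central` (above; one extra hypothesis
`|y₀| ≤ log x`), PROVED in tree: `GranvilleSoundararajan2003_theorem4_central_holds`
(`GranvilleSoundararajanTheorem4Proofs.lean`); its former consumers
(`MatomakiRadziwillL4A.lipschitz_of_GS`, `MatomakiRadziwill2016_lemma4_of_GS`) are superseded by the
`…_central` chain of `MatomakiRadziwillLemma4LipschitzCentral.lean`.  The statement below is unchanged,
kept only as the literal record and as the subject of its refutation; never take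
`(h : GranvilleSoundararajan2003_theorem4_sqrtRange)` as a hypothesis (anything follows) — every use of
the name now raises a deprecation warning pointing at the corrected fact.
[cite: GranvilleSoundararajan2003, Theorem 4 (arXiv p. 2) and §6, every-maximiser reading — refuted in tree (GranvilleSoundararajan2003_theorem4_sqrtRange_false); corrected as GranvilleSoundararajan2003_theorem4_central] -/
@[deprecated GranvilleSoundararajan2003_theorem4_central "refuted by \
  Literature.NumberTheory.LFunctions.GranvilleSoundararajan.GranvilleSoundararajan2003_theorem4_sqrtRange_false \
  (GranvilleSoundararajan2003Theorem4EdgeRefutation.lean; false for maximisers at the edge of the window); \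
  use GranvilleSoundararajan2003_theorem4_central (maximisers with |y₀| ≤ log x; proved: \
  GranvilleSoundararajan2003_theorem4_central_holds, GranvilleSoundararajanTheorem4Proofs.lean)"
  (since := "2026-08-15")]
def GranvilleSoundararajan2003_theorem4_sqrtRange : Prop :=
  ∃ C x₀ : ℝ, ∀ f : ArithmeticFunction ℂ, f.IsMultiplicative → (∀ n, ‖f n‖ ≤ 1) →
    ∀ x : ℝ, x₀ ≤ x → ∀ y₀ : ℝ, |y₀| ≤ 2 * Real.log x →
      (∀ y : ℝ, |y| ≤ 2 * Real.log x →
        ‖truncEulerProduct f x (1 + y * I)‖ ≤ ‖truncEulerProduct f x (1 + y₀ * I)‖) →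
      ∀ w : ℝ, 1 ≤ w → w ≤ Real.sqrt x →
        ‖(x : ℂ)⁻¹ * ∑ n ∈ Icc 1 ⌊x⌋₊, f n * (n : ℂ) ^ (-(y₀ * I))
            - ((w / x : ℝ) : ℂ) * ∑ n ∈ Icc 1 ⌊x / w⌋₊, f n * (n : ℂ) ^ (-(y₀ * I))‖ ≤
          C * ((Real.log (2 * w) / Real.log x) ^ (1 - 2 / Real.pi)
                  * Real.log (Real.log x / Real.log (2 * w))
                + Real.log (Real.log x) ^ (1 + 2 * (1 - 2 / Real.pi)) / Real.log x ^ (1 - 2 / Real.pi))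

end Literature.NumberTheory.LFunctions.GranvilleSoundararajan
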